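import Mathlib
import Summits.ResolutionOfSingularities.ResolutionOfSingularities.Theorems.WeightedInvariantLocalWeightedDropNewtonSetChartLaws
import Summits.ResolutionOfSingularities.ResolutionOfSingularities.Theorems.WeightedInvariantLocalWeightedDropWildMonicFlagDefs
import Summits.ResolutionOfSingularities.ResolutionOfSingularities.Theorems.WeightedInvariantLocalWeightedDropWildMonicFlagN1Transport

/-!
# `WeightedInvariant.LocalWeightedDrop`, line `hasse-ridge-face-selection`, S3ρ sub-stub S3ρD `stub_wildMonicSurfaceDescent`:
# CASE D-c — TANGENT FLAGS (`n_𝓕 ≥ 1`) under the monomial point step: the weighted order drops by the scale, the tangency by one,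
# and the initial height is KEPT (point sets)

Crux item stmt-ResolutionOfSingularities-8899 `LocalWeightedDrop` (route `ResolutionOfSingularities/WeightedInvariant`), engine of the
door `HypersurfaceCentreConstruction` stmt-ResolutionOfSingularities-19897.  [OURS · L1 W4.3, chain w43, res-L1-w43-stub-5 = seat
res-D-pv-056, third seat on S3ρ under res-type-083 (cases D-b/D-c of `L/res-type-083/S3RHO-DESIGN.md` §1(D)); sibling of
`…WildMonicFlagN1Transport` / `…WildMonicFlagN1TermMono`.  MODEL: Perlega, arXiv:2011.14443, Ch. 9 Prop. 9.1.1, bullet `n_𝓕 > 1`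
(«`n_{𝓕′} = n_𝓕 − 1`, `d_{𝓕′} = d_𝓕`», proof: «`(m_{𝓕′,x′}, d_{𝓕′,x′}) = ψ_{𝓕,x}(J_{2,x}(a)) − (c!, 0)`») and Prop. 9.1.4 case (3);
nothing here is a statement of H. Hironaka's manuscript; OUR lemmas about OUR point-set numbers.]

THE SITUATION.  In the subordinate coordinates of a TANGENT flag `𝓕 = (V(y) ⊃ V(y, x₂))` whose curve `V(y, x₂)` touches the boundary
component `D = V(x₂ − λ x₁ⁿ − …)` to order `n = n_𝓕 ≥ 1` (the legal non-linear plane move `x₂ ↦ x₂ + λ x₁ⁿ` puts the flag in coordinate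
position), Perlega reads the coefficient ideal `J₂` with the WEIGHTS `ω = (1, n)`: `m_{𝓕,x} = ω(J₂)` and `d_{𝓕,x} =` the least height `P₁`
over the `ω`-INITIAL LINE `{P : P₀ + n P₁ = ω(J₂)}` of the scaled Newton set `N`.  When the point is blown up and the new point lies on the
strict transform of the flag curve (origin of the `x₁`-chart: the monomial map `psi L`, `L = d!`), the strict transform of `D` touches the
new flag curve to order `n − 1`, and ON POINT SETS: the `(1, n)`-weight of `P` minus `L` is the `(1, n−1)`-weight of `psi L P`, and the
height `P₁` is unchanged.  Hence `m′ = m − L`, the initial lines correspond point by point, and `d_{𝓕′,x′} = d_{𝓕,x}` — the lexicographic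
drop `(d, n) ↦ (d, n − 1)` of the PACKAGE steps (Hauser–Perlega 2024 p. 781).

CONTENTS (def-free; the weighted order is written `sInf ((fun P => P 0 + n * P 1) '' N)`):
* `weightLine_psi_add` — `(psi L P)₀ + n (psi L P)₁ + L = P₀ + (n+1) P₁` for `L ≤ P₀ + P₁`;
* `wOrd_image_psi_add` — `ω_{(1,n)}(psi L '' N) + L = ω_{(1,n+1)}(N)` (type-o7's `deltaL_image_psiC_add` is the case `n = 1`);
* `initial_image_psi_iff` — `psi L P` is `(1,n)`-initial in the image iff `P` is `(1,n+1)`-initial in the source (same height `P₁`);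
* `initialMin_image_psi` — the LEAST INITIAL HEIGHT IS KEPT: a source point of least height on the source initial line maps to an image
  point of least height on the image initial line: `d_{𝓕′,x′} = d_{𝓕,x}`, `n ↦ n − 1`;
* `dRes_lost_image_psi_le_gammaL` — the case `n_𝓕 = 1` in lead-1's vocabulary (stub-7's ROADMAP (C7) wording): after a kangaroo-direction
  step, `dRes {0} (psi L '' N) ≤ gammaL N` (`gammaL` = least height on the `δ`-face, `…MonicDescentLabels`).
The small-value conventions turning `(m_{𝓕,x}, d_{𝓕,x})` into `d_𝓕` (Per17 §7.2) commute with this transport (`L ∣ m ↔ L ∣ m − L`,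
`m ≥ (n+1)L ↔ m − L ≥ nL`) and belong to the measure (D-0), as does the domination of arbitrary valid flags at the new point (Prop. 7.4.7/7.4.9).
AI-written; gate-accepted means sorry-free with standard axioms, not refereed.
-/

set_option linter.dupNamespace false -- mandated namespace of this single-conjunct summit

namespace Summit.ResolutionOfSingularities.ResolutionOfSingularities.Theorems

namespace WildMonic

open MonicDescent

variable {N : Set (Fin 2 →₀ ℕ)} {L n : ℕ}

/-- THE WEIGHT LAW of the monomial map: `(psi L P)₀ + n·(psi L P)₁ + L = P₀ + (n + 1)·P₁` whenever `L ≤ P₀ + P₁`. -/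
theorem weightLine_psi_add (n : ℕ) {P : Fin 2 →₀ ℕ} (hP : L ≤ P 0 + P 1) :
    psi L P 0 + n * psi L P 1 + L = P 0 + (n + 1) * P 1 := by
  rw [psi_apply_zero, psi_apply_one]
  have : (n + 1) * P 1 = n * P 1 + P 1 := by ring
  omega

/-- THE WEIGHTED ORDER DROPS BY THE SCALE AND THE WEIGHT BY ONE (Perlega Prop. 9.1.1, `n_𝓕 > 1`: «`m_{𝓕′,x′} = m_{𝓕,x} − c!`»):
`ω_{(1,n)}(psi L '' N) + L = ω_{(1,n+1)}(N)`. -/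
theorem wOrd_image_psi_add (n : ℕ) (hN : N.Nonempty) (hL : ∀ P ∈ N, L ≤ P 0 + P 1) :
    sInf ((fun P : Fin 2 →₀ ℕ => P 0 + n * P 1) '' (psi L '' N)) + L =
      sInf ((fun P : Fin 2 →₀ ℕ => P 0 + (n + 1) * P 1) '' N) := by
  apply le_antisymm
  · obtain ⟨P, hP, hPw⟩ := Nat.sInf_mem (hN.image (fun P : Fin 2 →₀ ℕ => P 0 + (n + 1) * P 1))
    have hPw' : P 0 + (n + 1) * P 1 = sInf ((fun P : Fin 2 →₀ ℕ => P 0 + (n + 1) * P 1) '' N) := hPw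
    have h : sInf ((fun P : Fin 2 →₀ ℕ => P 0 + n * P 1) '' (psi L '' N)) ≤ psi L P 0 + n * psi L P 1 :=
      Nat.sInf_le ⟨psi L P, ⟨P, hP, rfl⟩, rfl⟩
    have hw := weightLine_psi_add n (hL P hP)
    omega
  · obtain ⟨Q, ⟨P, hP, rfl⟩, hQw⟩ :=
      Nat.sInf_mem ((hN.image (psi L)).image (fun P : Fin 2 →₀ ℕ => P 0 + n * P 1))
    have hQw' : psi L P 0 + n * psi L P 1 = sInf ((fun P : Fin 2 →₀ ℕ => P 0 + n * P 1) '' (psi L '' N)) := hQw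
    have h : sInf ((fun P : Fin 2 →₀ ℕ => P 0 + (n + 1) * P 1) '' N) ≤ P 0 + (n + 1) * P 1 := Nat.sInf_le ⟨P, hP, rfl⟩
    have hw := weightLine_psi_add n (hL P hP)
    omega

/-- INITIAL POINTS CORRESPOND: for `P ∈ N`, the image `psi L P` lies on the `(1,n)`-initial line of the image set iff `P` lies on the
`(1,n+1)`-initial line of the source; the height is the same (`(psi L P)₁ = P₁`). -/
theorem initial_image_psi_iff (n : ℕ) (hN : N.Nonempty) (hL : ∀ P ∈ N, L ≤ P 0 + P 1) {P : Fin 2 →₀ ℕ} (hP : P ∈ N) :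
    psi L P 0 + n * psi L P 1 = sInf ((fun P : Fin 2 →₀ ℕ => P 0 + n * P 1) '' (psi L '' N)) ↔
      P 0 + (n + 1) * P 1 = sInf ((fun P : Fin 2 →₀ ℕ => P 0 + (n + 1) * P 1) '' N) := by
  have hlaw := wOrd_image_psi_add n hN hL
  have hw := weightLine_psi_add n (hL P hP)
  omega

/-- THE INITIAL HEIGHT IS KEPT (Perlega Prop. 9.1.1, `n_𝓕 > 1`: «`d_{𝓕′,x′} = d_{𝓕,x}`», and for `n_𝓕 = 1` the reading of the face
height after the step): if `P ∈ N` lies on the `(1,n+1)`-initial line of `N` with the least height among initial points, then `psi L P` lies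
on the `(1,n)`-initial line of the image with the least height among ITS initial points, and that height is `P₁`. -/
theorem initialMin_image_psi (n : ℕ) (hN : N.Nonempty) (hL : ∀ P ∈ N, L ≤ P 0 + P 1) {P : Fin 2 →₀ ℕ} (hP : P ∈ N)
    (hPi : P 0 + (n + 1) * P 1 = sInf ((fun P : Fin 2 →₀ ℕ => P 0 + (n + 1) * P 1) '' N))
    (hPmin : ∀ R ∈ N, R 0 + (n + 1) * R 1 = sInf ((fun P : Fin 2 →₀ ℕ => P 0 + (n + 1) * P 1) '' N) → P 1 ≤ R 1) :
    psi L P ∈ psi L '' N ∧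
      psi L P 0 + n * psi L P 1 = sInf ((fun P : Fin 2 →₀ ℕ => P 0 + n * P 1) '' (psi L '' N)) ∧
      psi L P 1 = P 1 ∧
      ∀ Q ∈ psi L '' N, Q 0 + n * Q 1 = sInf ((fun P : Fin 2 →₀ ℕ => P 0 + n * P 1) '' (psi L '' N)) → P 1 ≤ Q 1 := by
  refine ⟨⟨P, hP, rfl⟩, (initial_image_psi_iff n hN hL hP).mpr hPi, psi_apply_one L P, ?_⟩
  rintro Q ⟨R, hR, rfl⟩ hQi
  rw [psi_apply_one]
  exact hPmin R hR ((initial_image_psi_iff n hN hL hR).mp hQi)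

/-- Existence of a least-height initial point (so that `d_{𝓕,x}` for the weight `(1, n+1)` is attained). -/
theorem exists_initialMin (n : ℕ) (hN : N.Nonempty) :
    ∃ P ∈ N, P 0 + (n + 1) * P 1 = sInf ((fun P : Fin 2 →₀ ℕ => P 0 + (n + 1) * P 1) '' N) ∧
      ∀ R ∈ N, R 0 + (n + 1) * R 1 = sInf ((fun P : Fin 2 →₀ ℕ => P 0 + (n + 1) * P 1) '' N) → P 1 ≤ R 1 := by
  classical
  set w := sInf ((fun P : Fin 2 →₀ ℕ => P 0 + (n + 1) * P 1) '' N) with hw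
  have hI : ((fun P : Fin 2 →₀ ℕ => P 1) '' {P | P ∈ N ∧ P 0 + (n + 1) * P 1 = w}).Nonempty := by
    obtain ⟨P, hP, hPw⟩ := Nat.sInf_mem (hN.image (fun P : Fin 2 →₀ ℕ => P 0 + (n + 1) * P 1))
    exact ⟨P 1, P, ⟨hP, hPw⟩, rfl⟩
  obtain ⟨P, ⟨hP, hPw⟩, hPh⟩ := Nat.sInf_mem hI
  have hPh' : P 1 = sInf ((fun P : Fin 2 →₀ ℕ => P 1) '' {P | P ∈ N ∧ P 0 + (n + 1) * P 1 = w}) := hPh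
  refine ⟨P, hP, hPw, fun R hR hRw => ?_⟩
  rw [hPh']
  exact Nat.sInf_le ⟨R, ⟨hR, hRw⟩, rfl⟩

/-- ITERATION ALONG A PACKAGE (Hauser–Perlega 2024 p. 781: `n` monomial steps while the new point stays on the flag curve): after `j ≤ n`
steps the `(1, n − j)`-weighted order is the `(1, n)`-weighted order minus `j·L` — stated for one more step in the form the induction uses:
the weight law composes. -/
theorem wOrd_image_psi_image_psi_add (n : ℕ) (hN : N.Nonempty) (hL : ∀ P ∈ N, L ≤ P 0 + P 1)
    (hL' : ∀ Q ∈ psi L '' N, L ≤ Q 0 + Q 1) :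
    sInf ((fun P : Fin 2 →₀ ℕ => P 0 + n * P 1) '' (psi L '' (psi L '' N))) + 2 * L =
      sInf ((fun P : Fin 2 →₀ ℕ => P 0 + (n + 2) * P 1) '' N) := by
  have h1 := wOrd_image_psi_add n (hN.image (psi L)) hL'
  have h2 : sInf ((fun P : Fin 2 →₀ ℕ => P 0 + (n + 1) * P 1) '' (psi L '' N)) + L =
      sInf ((fun P : Fin 2 →₀ ℕ => P 0 + (n + 2) * P 1) '' N) := wOrd_image_psi_add (n + 1) hN hL
  omega

/-- CASE `n_𝓕 = 1` IN LEAD-1's VOCABULARY (stub-7's ROADMAP (C7): «`d′ ≤ ord_{(y)} in(J₂) = gammaL N`»): after a kangaroo-direction point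
step (both boundary components lost, `E′ = {V(s)}`), the residual order of the successor is at most `gammaL N`, the least height on the
`δ`-face of the sheared source (`dRes_lost_image_psi_le` at the point realising `gammaL`). -/
theorem dRes_lost_image_psi_le_gammaL (hN : N.Nonempty) (hL : ∀ P ∈ N, L ≤ P 0 + P 1) :
    dRes {0} (psi L '' N) ≤ gammaL N := by
  obtain ⟨P, hP, hPd, hPγ⟩ := exists_eq_gammaL hN
  rw [← hPγ]
  exact dRes_lost_image_psi_le hN hL hP hPd

end WildMonic

end Summit.ResolutionOfSingularities.ResolutionOfSingularities.Theorems
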